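import Summits.BirchSwinnertonDyer.Rank1Residual.GaloisImage.KolyvaginInjectivityAllDepthsEnd
import Summits.BirchSwinnertonDyer.Rank1Residual.GaloisImage.SelmerGroupFinite
import HarnessLib

/-!
# `#KS(E[3^k·3], 𝓕_can) ≤ #H¹_{𝓕_can}(ℚ, E[3^k·3])` at every depth — the cardinality corollary of
# the [S24]-free injectivity at the core vertex `∅`
# (cell `b2b-bsdres`, team n1011, row T-INJ-DEV-K, file K5; seat p11 GEN 6; lead R5-69/R5-70/R5-71)

HONEST FRAMING (cell `b2b-bsdres`, run/shared/lean/b2b/bsd-rank1-residual/, verbatim in every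
file): the goal of the cell is to DELETE the COMBINATION-SHAPED residual classes of the
Birch–Swinnerton-Dyer formula for ALL analytic-rank `≤ 1` elliptic curves over `ℚ` — "full BSD
formula for every rank `≤ 1` curve in class `C`" assembled STRICTLY from published theorems — so
that the rank-`≤ 1` remainder becomes exactly the CONSTRUCTION-SHAPED classes, which are TYPED
(missing-input `Prop`s), NOT attempted. This is not "finishing BSD". Team n1011 (N10 / N11, the
additive block X4 ∧ `p = 3`): research route on the CONSTRUCTION-SHAPED class X4; TOOL theorems; no
class theorem; nothing is booked; no label and no RESIDUAL-MAP mark is moved. Theorems only: no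
definition, no named fact, no `sorry`.

## What

`TorsionLevel.natCard_kolyvaginSystems_le_allDepths`: under the hypotheses of the END
`TorsionLevel.apply_eq_zero_of_apply_empty_eq_zero_allDepths` (K4), the group of Kolyvagin systems of
`(E[3^k·3], 𝓕_can, D k)` is finite of order at most `#H¹_{𝓕_can}(ℚ, E[3^k·3])`, for every `k ≥ 1`:
`κ ↦ κ_∅` embeds it into the level-`k` Selmer group (`injective_eval_kolyvaginSystems_empty_allDepths`),
which is finite for a structure unramified outside `S` (n1011-p13's
`SelmerFinite.finite_selmerGroup_of_isUnramifiedOutside`).  The `m = 1` analogue is n1011-p11's R1-58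
`CoreRankOne.natCard_kolyvaginSystems_le_of_empty`.  Nothing booked.

References: R. Sakamoto, JTNB 36 (2024) Thm. 4.4 (1) [Sakamoto2024]; K. Rubin, PCMI 18 (2011)
Cor. 2.8.9 (2) [Rubin2011].
-/

noncomputable section

open scoped Classical NumberField ContRepresentation
open Field NumberField IsDedekindDomain Module
open WeierstrassCurve Literature.NumberTheory.EllipticCurves Literature.NumberTheory.GaloisRepresentations
  Literature.NumberTheory.GaloisRepresentations.DiscreteGaloisModule Literature.NumberTheory.GaloisCohomology

namespace Summit.BirchSwinnertonDyer.Rank1Residual.GaloisImage.TorsionLevel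

variable (W : WeierstrassCurve ℚ) [W.IsElliptic]

/-- **`#KS(E[3^k·3], 𝓕_can, D k) ≤ #H¹_{𝓕_can}(ℚ, E[3^k·3])` for every `k ≥ 1`** when `∅` is a
core vertex of `𝓕̄_can` — the Kolyvagin systems at depth `k` form a FINITE group embedded in the
level-`k` Selmer group by `κ ↦ κ_∅` (`injective_eval_kolyvaginSystems_empty_allDepths`; finiteness of
the Selmer group of a structure unramified outside `S` = n1011-p13's
`SelmerFinite.finite_selmerGroup_of_isUnramifiedOutside`).  Same binders as the END.
[cite: Sakamoto2024, Thm. 4.4 (1) (p. 926)] [cite: Rubin2011, Cor. 2.8.9 (2) (p. 25)] -/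
theorem natCard_kolyvaginSystems_le_allDepths [Finite (geomTorsion W ((3 : ℕ) : ℤ))]
    (h3 : W.HasSurjectiveModNGaloisRep ((3 : ℕ) : ℤ)) (k : ℕ) (hk : 1 ≤ k)
    (τ : absoluteGaloisGroup ℚ) (hτμ : τ ∈ rootsOfUnityFixer ℚ (3 ^ (k + 1)))
    (hτ : ∀ j, j ≤ k → Nonempty (cokerSubOne (W.torsionGaloisModule (((3 : ℕ) : ℤ) ^ j * ((3 : ℕ) : ℤ))) τ ≃+
      ZMod (3 ^ (j + 1))))
    (hτq : Nonempty (cokerSubOne (W.torsionGaloisModule ((3 : ℕ) : ℤ)) τ ≃+ ZMod 3))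
    (inv : LocalInvariants ℚ 3) (hperf : inv.IsPerfect) (hsum : inv.SumLocalTermEqZero)
    (hcompl : inv.SelmerComplement)
    (hEP : ∀ v : HeightOneSpectrum (𝓞 ℚ), localEulerPoincareCharacteristic (v.adicCompletion ℚ))
    (S : Finset (Place ℚ)) (hS : ∀ w : InfinitePlace ℚ, (Sum.inl w : Place ℚ) ∈ S)
    (h3S : ∀ v : HeightOneSpectrum (𝓞 ℚ), ((3 : ℕ) : 𝓞 ℚ) ∈ v.asIdeal → (Sum.inr v : Place ℚ) ∈ S)
    (hbadS : ∀ v : HeightOneSpectrum (𝓞 ℚ), ¬ W.HasGoodReductionAt v → (Sum.inr v : Place ℚ) ∈ S)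
    (D : (j : ℕ) → KolyvaginDatum (W.torsionGaloisModule (((3 : ℕ) : ℤ) ^ j * ((3 : ℕ) : ℤ))))
    (D₁ : KolyvaginDatum (W.torsionGaloisModule ((3 : ℕ) : ℤ)))
    (η : (q : HeightOneSpectrum (𝓞 ℚ)) → (ZMod (Ideal.absNorm q.asIdeal))ˣ)
    (hP : ∀ j, j ≤ k → (D j).primes = frobeniusClassPrimes
      (W.torsionGaloisModule (((3 : ℕ) : ℤ) ^ k * ((3 : ℕ) : ℤ))) {v | (Sum.inr v : Place ℚ) ∈ S} τ (3 ^ (k + 1)))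
    (hP₁ : D₁.primes = frobeniusClassPrimes
      (W.torsionGaloisModule (((3 : ℕ) : ℤ) ^ k * ((3 : ℕ) : ℤ))) {v | (Sum.inr v : Place ℚ) ∈ S} τ (3 ^ (k + 1)))
    (hT : ∀ j, j ≤ k → (D j).transverse = cyclotomicTransverse _)
    (hT₁ : D₁.transverse = cyclotomicTransverse _)
    (hD : ∀ j, j ≤ k → (D j).HasCanonicalComparison (3 ^ (j + 1)) η) (hD₁ : D₁.HasCanonicalComparison 3 η)
    (hadm : ∀ j, j ≤ k → (D j).IsAdmissible)
    (hcore : (inv.dualSelmerStructure (W.torsionGaloisModule ((3 : ℕ) : ℤ))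
      (D₁.atLevel (propagatedSelmerStructureOne W 3) ∅)).selmerGroup = ⊥) :
    Nat.card ((D k).kolyvaginSystems (propagatedSelmerStructure W 3 k)) ≤
      Nat.card (propagatedSelmerStructure W 3 k).selmerGroup := by
  haveI : Fact (Nat.Prime 3) := ⟨Nat.prime_three⟩
  haveI : Finite (geomTorsion W (((3 : ℕ) : ℤ) ^ k * ((3 : ℕ) : ℤ))) := finite_geomTorsion_pow_mul W 3 k
  haveI : Finite (propagatedSelmerStructure W 3 k).selmerGroup :=
    SelmerFinite.finite_selmerGroup_of_isUnramifiedOutside _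
      (fun v hv => (not_mem_and_isUnramifiedAt_of_not_mem W 3 k S h3S hbadS hv).2)
      (propagatedSelmerStructure_isUnramifiedOutside W 3 k S hS h3S hbadS)
  have hlev : (D k).atLevel (propagatedSelmerStructure W 3 k) ∅ = propagatedSelmerStructure W 3 k :=
    SelmerStructure.modify_empty _ (D k).transverse
  -- `κ ↦ κ_∅` with values in the Selmer group of `𝓕_can`
  have hmem : ∀ κ : (D k).kolyvaginSystems (propagatedSelmerStructure W 3 k),
      κ.1 ∅ ∈ (propagatedSelmerStructure W 3 k).selmerGroup := fun κ => by
    have h := ((KolyvaginDatum.mem_kolyvaginSystems_iff _ _ κ.1).mp κ.2).mem_selmerGroup ∅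
      (D k).isLevel_empty
    rwa [hlev] at h
  let f : (D k).kolyvaginSystems (propagatedSelmerStructure W 3 k) →
      (propagatedSelmerStructure W 3 k).selmerGroup := fun κ => ⟨κ.1 ∅, hmem κ⟩
  refine Nat.card_le_card_of_injective f fun κ κ' h => ?_
  exact injective_eval_kolyvaginSystems_empty_allDepths W h3 k hk τ hτμ hτ hτq inv hperf hsum hcompl hEP S
    hS h3S hbadS D D₁ η hP hP₁ hT hT₁ hD hD₁ hadm hcore (congrArg Subtype.val h)

end Summit.BirchSwinnertonDyer.Rank1Residual.GaloisImage.TorsionLevel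

end
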